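import Mathlib
import HarnessLib
import Literature.AlgebraicGeometry.Morphisms.CechH1LengthComparison
import Literature.AlgebraicGeometry.Morphisms.CechH1LengthTransport
import Literature.AlgebraicGeometry.Morphisms.CechH1PreimageGluing
import Literature.AlgebraicGeometry.Morphisms.CechH1PreimageGluingProjective
import Literature.AlgebraicGeometry.Morphisms.SeparatedAffinePreimage
import Literature.AlgebraicGeometry.Resolution.ResolutionFibreDimension
import Literature.AlgebraicGeometry.Resolution.ExceptionalCurvePoints
import Summits.ResolutionOfSingularities.ResolutionOfSingularities.Theorems.HomologicalConductorSurfaceTerminationGenusDefs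
import Summits.ResolutionOfSingularities.ResolutionOfSingularities.Theorems.HomologicalConductorSurfaceTerminationGenusDomination
import Summits.ResolutionOfSingularities.ResolutionOfSingularities.Theorems.HomologicalConductorSurfaceTerminationChartResolutionBirational

/-!
# Kill test `SurfaceTermination` (stmt-ResolutionOfSingularities-16488), LINE genus-descent, stub
# `stub_pgNonincreasing` (U2e): the geometric genus of a localised chart is bounded by that of the base

`[OURS · L W4.4]` Cell res-hironaka, crux chain W4.4, kill test K4.4-s; U2e ASSEMBLY CORE (res-D-pv-045,
plan of record res-L0-w44-stub-4 11:36:48Z / res-L0-w44-plan-1 (ρ28b)).  Nothing here is a statement of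
the manuscript under review (Hironaka 2017); AI-written, weaker than expert review.

## The core theorem `hasGeometricGenusLE_of_chart`

ABSTRACT DATA (no towers): `T` a Noetherian local domain of dimension `≤ 2`; a resolution
`ξ : X → Spec T` with `length_T Ȟ¹(𝒰, 𝒪_X) ≤ g` for every finite affine cover; a regular `Z` with a
proper birational `τ : Z → X`; a proper birational INTEGRAL model `g_B : B → Spec T` and
`σ_B : Z → B` over `Spec T`; a finite affine cover `𝒲` of `B` with a distinguished member `W_{a₀}` such
that every MIXED piece `σ_B⁻¹(W_{a₀} ∩ W_b)`, `b ≠ a₀`, is `Ȟ¹`-acyclic; a resolution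
`σ : V = σ_B⁻¹(W_{a₀}) → Spec N` compatible with the `T`-structures; and a localisation `T'` of `N`.
CONCLUSION: `HasGeometricGenusLE T' g` — the base change `V ×_N Spec T' → Spec T'` is a resolution
(res-L0-w44-stub-1, `ChartResolution.isResolution_pullback_snd_of_isLocalization`) and for every finite
affine cover of it

  `ℓ_{T'} Ȟ¹ = ℓ_{T'} Ȟ¹(g'⁻¹𝒢)` (cover independence, stub-4 `length_cechH1_eq_of_isAffineOpen`)
  `≤ ℓ_N Ȟ¹(𝒢)` (localisation, U2b + stub-4 `length_cechH1_le_of_isLocalization`)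
  `≤ ℓ_T Ȟ¹(𝒢)` (change of ring, stub-4 `length_cechH1_le_length_cechH1_comp`)
  `= ℓ_T Ȟ¹((U_i ∩ V)_i)` (transport along `V ↪ Z`, `length_cechH1_preimageFamily_eq_of_isOpenImmersion`)
  `≤ ℓ_T Ȟ¹(𝒰)` (GW-GLUE, stub-4 `length_cechH1_preimage_piece_le_of_GW`, mod Görtz–Wedhorn 24.44-H²)
  `= ℓ_T Ȟ¹(𝒲_Z) ≤ ℓ_T Ȟ¹(𝒰_X) ≤ g` (cover independence; domination U2c `length_cechH1_le_of_dominates`,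
  mod Lipman (1.2)),

where `𝒰` is a finite affine cover of `Z` refining `σ_B⁻¹𝒲`, `𝒢 = (U_i ∩ V)_i` on `V`, `𝒲_Z` a finite
affine cover of `Z` refining `τ⁻¹𝒰_X`.  Helpers: `exists_finite_affine_refinement`.

References: U. Görtz, T. Wedhorn, *Algebraic Geometry II* (2023), Cor. 21.82, Cor. 24.44
[`GortzWedhorn2023`]; J. Lipman, Publ. IHÉS 36 (1969), Prop. (1.2) [`Lipman1969`]; A. Grothendieck,
EGA III₁ (1961), (1.4.15) [`EGAIII1`]; M. Artin, in *Arithmetic Geometry* (1986), Prop. (3.2)(i) (the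
printed `R¹` Leray sequence this replaces) [`Artin1986`].
-/

-- single-problem summit: the doubled namespace component `ResolutionOfSingularities` is forced
set_option linter.dupNamespace false

noncomputable section

open CategoryTheory CategoryTheory.Limits AlgebraicGeometry TopologicalSpace IsLocalRing
open Literature.AlgebraicGeometry.Resolution Literature.AlgebraicGeometry.Morphisms
open Literature.AlgebraicGeometry.Morphisms.CechLocalization
open Summit.ResolutionOfSingularities.ResolutionOfSingularities.Theorems

namespace Summit.ResolutionOfSingularities.ResolutionOfSingularities.Theorems.SurfaceTermination.GenusDescent

/-! ## Finite affine refinements -/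

/-- **Finite affine refinement of an open cover of a quasi-compact scheme**: affine opens form a
basis, and finitely many of those inside members of the cover still cover. [folklore] -/
theorem exists_finite_affine_refinement (X : Scheme.{0}) [CompactSpace X] {α : Type}
    (O : α → X.Opens) (hO : ⨆ a, O a = ⊤) :
    ∃ (ι : Type) (_ : Finite ι) (U : ι → X.Opens) (r : ι → α),
      (∀ i, IsAffineOpen (U i)) ∧ (∀ i, U i ≤ O (r i)) ∧ ⨆ i, U i = ⊤ := by
  classical
  have hpt : ∀ x : X, ∃ p : X.Opens × α, IsAffineOpen p.1 ∧ x ∈ p.1 ∧ p.1 ≤ O p.2 := by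
    intro x
    have hx : x ∈ ⨆ a, O a := by rw [hO]; trivial
    obtain ⟨a, ha⟩ := Opens.mem_iSup.mp hx
    obtain ⟨U, hU, hxU, hUO⟩ := Opens.isBasis_iff_nbhd.mp X.isBasis_affineOpens ha
    exact ⟨(U, a), hU, hxU, hUO⟩
  choose p hp using hpt
  obtain ⟨t, ht⟩ := IsCompact.elim_finite_subcover CompactSpace.isCompact_univ
    (fun x : X => ((p x).1 : Set X)) (fun x => (p x).1.2)
    (fun x _ => Set.mem_iUnion.mpr ⟨x, (hp x).2.1⟩)
  refine ⟨↥t, inferInstance, fun i => (p i.1).1, fun i => (p i.1).2, fun i => (hp i.1).1,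
    fun i => (hp i.1).2.2, ?_⟩
  refine top_le_iff.mp fun x _ => ?_
  have hx := ht (Set.mem_univ x)
  simp only [Set.mem_iUnion] at hx
  obtain ⟨y, hy, hxy⟩ := hx
  exact Opens.mem_iSup.mpr ⟨⟨y, hy⟩, hxy⟩

/-- A finite affine open cover of a quasi-compact scheme. [folklore] -/
theorem exists_finite_affine_cover (X : Scheme.{0}) [CompactSpace X] :
    ∃ (ι : Type) (_ : Finite ι) (U : ι → X.Opens), (∀ i, IsAffineOpen (U i)) ∧ ⨆ i, U i = ⊤ := by
  obtain ⟨ι, hι, U, -, hU, -, hcov⟩ :=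
    exists_finite_affine_refinement X (fun _ : Unit => (⊤ : X.Opens)) (by simp)
  exact ⟨ι, hι, U, hU, hcov⟩

/-! ## The core: genus bound for a localised chart -/

/-- Local rings of a resolution of a Noetherian domain of dimension `≤ 2` have dimension `≤ 2`
(`dim 𝒪_{X,x} = coheight x ≤ dim X ≤ dim T`). [cite: EGAIV2, 5.6.5.1] -/
theorem ringKrullDim_stalk_le_two_of_isResolution {T : Type} [CommRing T] [IsNoetherianRing T]
    [IsDomain T] [IsLocalRing T] (hdimT : ringKrullDim T ≤ 2) {X : Scheme.{0}}
    {ξ : X ⟶ Spec (.of T)} (hξ : IsResolution ξ) (x : X) :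
    ringKrullDim (X.presheaf.stalk x) ≤ 2 := by
  rw [ringKrullDim_stalk_eq_coheight]
  have h := hξ.height_add_coheight_le_two hdimT x
  have h2 : Order.coheight x ≤ 2 := le_trans le_add_self h
  have h3 : ((Order.coheight x : ℕ∞) : WithBot ℕ∞) ≤ ((2 : ℕ∞) : WithBot ℕ∞) :=
    WithBot.coe_le_coe.mpr h2
  exact h3

/-- Lattice bookkeeping: `a ⊓ c ⊓ (b ⊓ c) = a ⊓ b ⊓ c`. [folklore] -/
theorem inf_inf_inf_inf_eq {L : Type*} [Lattice L] (a b c : L) : a ⊓ c ⊓ (b ⊓ c) = a ⊓ b ⊓ c := by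
  apply le_antisymm
  · exact le_inf (le_inf (inf_le_left.trans inf_le_left) (inf_le_right.trans inf_le_left))
      (inf_le_left.trans inf_le_right)
  · exact le_inf (le_inf (inf_le_left.trans inf_le_left) inf_le_right)
      (le_inf (inf_le_left.trans inf_le_right) inf_le_right)

/-- Lattice bookkeeping: `a ⊓ d ⊓ (b ⊓ d) ⊓ (c ⊓ d) = a ⊓ b ⊓ c ⊓ d`. [folklore] -/
theorem inf_inf_inf_inf_inf_eq {L : Type*} [Lattice L] (a b c d : L) :
    a ⊓ d ⊓ (b ⊓ d) ⊓ (c ⊓ d) = a ⊓ b ⊓ c ⊓ d := by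
  rw [inf_inf_inf_inf_eq, inf_assoc (a ⊓ b) d, inf_comm d (c ⊓ d), inf_assoc c d d, inf_idem,
    ← inf_assoc]

/-- **Domination step with the bound.**  For a resolution `ξ : X → Spec T` (`dim T ≤ 2`) with
`ℓ_T Ȟ¹(𝒰_X) ≤ g` for all finite affine covers, and a regular `Z` with a proper birational `τ : Z → X`:
`ℓ_T Ȟ¹(𝒰, 𝒪_Z) ≤ g` for every finite affine cover `𝒰` of `Z` (cover independence + U2c
`length_cechH1_le_of_dominates`, mod Lipman (1.2)). [cite: Lipman1969, Proposition (1.2) (p. 199)]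
[cite: GortzWedhorn2023, Cor. 21.82 (p. 265)] -/
theorem length_cechH1_le_of_dominates_of_bound
    {T : Type} [CommRing T] [IsDomain T] [IsNoetherianRing T] [IsLocalRing T]
    (hdimT : ringKrullDim T ≤ 2) (h12 : Lipman1969_1_2.{0})
    {X : Scheme.{0}} (ξ : X ⟶ Spec (.of T)) (hξ : IsResolution ξ) (g : ℕ)
    (hbound : ∀ (ι : Type) [Finite ι] (U : ι → X.Opens), (∀ i, IsAffineOpen (U i)) →
      ⨆ i, U i = ⊤ → Module.length T (CechH1 ξ U) ≤ (g : ℕ∞))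
    {Z : Scheme.{0}} (τ : Z ⟶ X) [IsProper τ] (hτ : IsBirational τ) (hZreg : Scheme.IsRegular Z)
    {ι : Type} [Finite ι] (U : ι → Z.Opens) (hUaff : ∀ i, IsAffineOpen (U i)) (hUcov : ⨆ i, U i = ⊤) :
    Module.length T (CechH1 (τ ≫ ξ) U) ≤ (g : ℕ∞) := by
  classical
  haveI : IsProper ξ := hξ.isProper
  haveI : IsDomain (CommRingCat.of T) := ‹IsDomain T›
  haveI : IsNoetherianRing (CommRingCat.of T) := ‹IsNoetherianRing T›
  haveI : IsIntegral X := hξ.isIntegral_source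
  have hfZres : IsResolution (τ ≫ ξ) := ⟨inferInstance, hτ.comp hξ.isBirational, hZreg⟩
  haveI : IsIntegral Z := hfZres.isIntegral_source
  haveI : IsLocallyNoetherian Z := LocallyOfFiniteType.isLocallyNoetherian (τ ≫ ξ)
  haveI : CompactSpace Z := QuasiCompact.compactSpace_of_compactSpace (τ ≫ ξ)
  haveI : IsNoetherian Z := {}
  haveI : IsLocallyNoetherian X := LocallyOfFiniteType.isLocallyNoetherian ξ
  haveI : CompactSpace X := QuasiCompact.compactSpace_of_compactSpace ξ
  haveI : IsNoetherian X := {}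
  haveI : Z.IsSeparated := ⟨by rw [← terminal.comp_from (τ ≫ ξ)]; infer_instance⟩
  obtain ⟨ι', _, UX, hUXaff, hUXcov⟩ := exists_finite_affine_cover X
  obtain ⟨κ, _, WZ, rZ, hWZaff, hWZr, hWZcov⟩ := exists_finite_affine_refinement Z
    (fun i => τ ⁻¹ᵁ UX i) (by rw [← Scheme.Hom.preimage_iSup, hUXcov]; exact Opens.map_top _)
  have hdimX : ∀ x : X, ringKrullDim (X.presheaf.stalk x) ≤ 2 := fun x =>
    ringKrullDim_stalk_le_two_of_isResolution hdimT hξ x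
  have hUW : ∀ i j, IsAffineOpen (τ ⁻¹ᵁ UX i ⊓ WZ j) := fun i j => by
    rw [inf_comm]
    exact SeparatedAffinePreimage.isAffineOpen_inf_preimage τ ξ (hWZaff j) (hUXaff i)
  have hUW2 : ∀ i j j', IsAffineOpen (τ ⁻¹ᵁ UX i ⊓ WZ j ⊓ (τ ⁻¹ᵁ UX i ⊓ WZ j')) := by
    intro i j j'
    rw [inf_comm (τ ⁻¹ᵁ UX i) (WZ j), inf_comm (τ ⁻¹ᵁ UX i) (WZ j'), inf_inf_inf_inf_eq]
    exact SeparatedAffinePreimage.isAffineOpen_inf_preimage τ ξ ((hWZaff j).inf (hWZaff j'))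
      (hUXaff i)
  have hUW3 : ∀ i j j' j'', IsAffineOpen
      (τ ⁻¹ᵁ UX i ⊓ WZ j ⊓ (τ ⁻¹ᵁ UX i ⊓ WZ j') ⊓ (τ ⁻¹ᵁ UX i ⊓ WZ j'')) := by
    intro i j j' j''
    rw [inf_comm (τ ⁻¹ᵁ UX i) (WZ j), inf_comm (τ ⁻¹ᵁ UX i) (WZ j'), inf_comm (τ ⁻¹ᵁ UX i) (WZ j''),
      inf_inf_inf_inf_inf_eq]
    exact SeparatedAffinePreimage.isAffineOpen_inf_preimage τ ξ
      (((hWZaff j).inf (hWZaff j')).inf (hWZaff j'')) (hUXaff i)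
  calc Module.length T (CechH1 (τ ≫ ξ) U)
      = Module.length T (CechH1 (τ ≫ ξ) WZ) :=
        length_cechH1_eq_of_isAffineOpen (τ ≫ ξ) U WZ hUaff hWZaff hUcov hWZcov
    _ ≤ Module.length T (CechH1 ξ UX) :=
        length_cechH1_le_of_dominates ξ τ h12 hτ hZreg hξ.isRegular hdimX UX hUXaff WZ hWZcov rZ
          hWZr hUW hUW2 hUW3
    _ ≤ (g : ℕ∞) := hbound ι' UX hUXaff hUXcov

/-- **Chart step.**  For an `A`-scheme `f : Z → Spec A` (separated), a finite affine cover `𝒰` of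
`Z`, an open `V ⊆ Z` whose intersections with the `U_i` are affine, a resolution `σ : V → Spec N`
compatible with the structure maps through a ring map `A → N`, and a localisation `T'` of `N`: the
base change `V ×_N Spec T' → Spec T'` is a resolution whose `Ȟ¹` on every finite affine cover has
`ℓ_{T'} ≤ ℓ_A Ȟ¹((U_i ∩ V)_i, 𝒪_Z)`. [cite: EGAIII1, Prop. (1.4.15)] [cite: GortzWedhorn2023, Cor. 21.82 (p. 265)] -/
theorem exists_isResolution_length_cechH1_le_of_chart
    {A : Type} [CommRing A] {Z : Scheme.{0}} (f : Z ⟶ Spec (.of A)) [IsSeparated f]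
    {ι : Type} [Finite ι] (U : ι → Z.Opens) (hUaff : ∀ i, IsAffineOpen (U i)) (hUcov : ⨆ i, U i = ⊤)
    (V : Z.Opens) (hV : ∀ O : Z.Opens, IsAffineOpen O → IsAffineOpen (O ⊓ V))
    {N : Type} [CommRing N] [IsDomain N] [Algebra A N]
    (σ : ((V : Z.Opens) : Scheme.{0}) ⟶ Spec (.of N)) (hσ : IsResolution σ)
    (hσA : V.ι ≫ f = σ ≫ Spec.map (CommRingCat.ofHom (algebraMap A N)))
    (T' : Type) [CommRing T'] [IsDomain T'] [Algebra N T'] (M : Submonoid N) [IsLocalization M T'] :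
    ∃ (X' : Scheme.{0}) (f' : X' ⟶ Spec (.of T')), IsResolution f' ∧
      ∀ (ι' : Type) [Finite ι'] (U' : ι' → X'.Opens), (∀ i, IsAffineOpen (U' i)) → ⨆ i, U' i = ⊤ →
        Module.length T' (CechH1 f' U') ≤ Module.length A (CechH1 f (fun i => U i ⊓ V)) := by
  classical
  haveI : Z.IsSeparated := ⟨by rw [← terminal.comp_from f]; infer_instance⟩
  -- opens inside `V`
  have haffι : ∀ O : Z.Opens, O ≤ V → IsAffineOpen O → IsAffineOpen (V.ι ⁻¹ᵁ O) := by
    intro O hO hOa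
    rw [← V.ι.isAffineOpen_iff_of_isOpenImmersion, Scheme.Hom.image_preimage_eq_opensRange_inf,
      Scheme.Opens.opensRange_ι, inf_eq_right.mpr hO]
    exact hOa
  let G : ι → ((V : Z.Opens) : Scheme.{0}).Opens := preimageFamily V.ι (fun i => U i ⊓ V)
  have hGaff : ∀ i, IsAffineOpen (G i) := fun i => haffι _ inf_le_right (hV _ (hUaff i))
  have hG2 : ∀ i j, IsAffineOpen (G i ⊓ G j) := by
    intro i j
    change IsAffineOpen (V.ι ⁻¹ᵁ ((U i ⊓ V) ⊓ (U j ⊓ V)))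
    rw [inf_inf_inf_inf_eq]
    exact haffι _ inf_le_right (hV _ ((hUaff i).inf (hUaff j)))
  have hG3 : ∀ i j l, IsAffineOpen (G i ⊓ G j ⊓ G l) := by
    intro i j l
    change IsAffineOpen (V.ι ⁻¹ᵁ ((U i ⊓ V) ⊓ (U j ⊓ V) ⊓ (U l ⊓ V)))
    rw [inf_inf_inf_inf_inf_eq]
    exact haffι _ inf_le_right (hV _ (((hUaff i).inf (hUaff j)).inf (hUaff l)))
  have hGcov : ⨆ i, G i = ⊤ := by
    change ⨆ i, V.ι ⁻¹ᵁ (U i ⊓ V) = ⊤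
    rw [← Scheme.Hom.preimage_iSup, ← iSup_inf_eq, hUcov, top_inf_eq, Scheme.Opens.ι_preimage_self]
  -- transport along `V ↪ Z`, change of ring `A → N`
  have htrans : Module.length A (CechH1 (σ ≫ Spec.map (CommRingCat.ofHom (algebraMap A N))) G) =
      Module.length A (CechH1 f (fun i => U i ⊓ V)) :=
    length_cechH1_preimageFamily_eq_of_isOpenImmersion f _ V.ι hσA (fun i => U i ⊓ V)
      (fun i => by rw [Scheme.Opens.opensRange_ι]; exact inf_le_right)
  have hring : Module.length N (CechH1 σ G) ≤
      Module.length A (CechH1 (σ ≫ Spec.map (CommRingCat.ofHom (algebraMap A N))) G) :=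
    length_cechH1_le_length_cechH1_comp σ G
  -- the resolution of `T'`
  let X' : Scheme.{0} := pullback σ (Spec.map (CommRingCat.ofHom (algebraMap N T')))
  let f' : X' ⟶ Spec (.of T') := pullback.snd σ (Spec.map (CommRingCat.ofHom (algebraMap N T')))
  let g' : X' ⟶ (V : Scheme.{0}) := pullback.fst σ (Spec.map (CommRingCat.ofHom (algebraMap N T')))
  have hf' : IsResolution f' := ChartResolution.isResolution_pullback_snd_of_isLocalization M σ hσ
  have hloc : Module.length T' (CechH1 f' (preimageFamily g' G)) ≤ Module.length N (CechH1 σ G) :=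
    length_cechH1_le_of_isLocalization M σ f' g' (IsPullback.of_hasPullback σ _) G hGaff hG2 hG3
  haveI : IsAffineHom g' := MorphismProperty.pullback_fst _ _ inferInstance
  have hG'aff : ∀ i, IsAffineOpen (preimageFamily g' G i) := fun i => (hGaff i).preimage g'
  have hG'cov : ⨆ i, preimageFamily g' G i = ⊤ := by
    change ⨆ i, g' ⁻¹ᵁ G i = ⊤
    rw [← Scheme.Hom.preimage_iSup, hGcov]; exact Opens.map_top _
  refine ⟨X', f', hf', fun ι' _ U' hU' hU'cov => ?_⟩
  calc Module.length T' (CechH1 f' U')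
      = Module.length T' (CechH1 f' (preimageFamily g' G)) :=
        length_cechH1_eq_of_isAffineOpen f' U' (preimageFamily g' G) hU' hG'aff hU'cov hG'cov
    _ ≤ Module.length N (CechH1 σ G) := hloc
    _ ≤ Module.length A (CechH1 (σ ≫ Spec.map (CommRingCat.ofHom (algebraMap A N))) G) := hring
    _ = Module.length A (CechH1 f (fun i => U i ⊓ V)) := htrans

/-- **U2e core — the geometric genus of a localised chart is bounded by the genus of the base.**
See the module docstring for the data and the chain of (in)equalities.  Conditional on the named
facts `Lipman1969_1_2` (domination step) and `GortzWedhorn2023_24_44_H2` (gluing step).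
[cite: GortzWedhorn2023, Cor. 24.44] [cite: Lipman1969, Proposition (1.2) (p. 199)]
[cite: EGAIII1, Prop. (1.4.15)] -/
theorem hasGeometricGenusLE_of_chart
    {T : Type} [CommRing T] [IsDomain T] [IsNoetherianRing T] [IsLocalRing T]
    (hdimT : ringKrullDim T ≤ 2)
    (h12 : Lipman1969_1_2.{0}) (hGW : GortzWedhorn2023_24_44_H2.{0})
    -- the given resolution with the genus bound
    {X : Scheme.{0}} (ξ : X ⟶ Spec (.of T)) (hξ : IsResolution ξ) (g : ℕ)
    (hbound : ∀ (ι : Type) [Finite ι] (U : ι → X.Opens), (∀ i, IsAffineOpen (U i)) →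
      ⨆ i, U i = ⊤ → Module.length T (CechH1 ξ U) ≤ (g : ℕ∞))
    -- a regular `Z` dominating `X`
    {Z : Scheme.{0}} (τ : Z ⟶ X) [IsProper τ] (hτ : IsBirational τ) (hZreg : Scheme.IsRegular Z)
    -- the middle model `B` and `σ_B : Z → B` over `Spec T`
    {B : Scheme.{0}} [IsIntegral B] (gB : B ⟶ Spec (.of T)) [IsProper gB] (hgB : IsBirational gB)
    (σB : Z ⟶ B) (hσB : σB ≫ gB = τ ≫ ξ)
    -- a finite affine cover of `B` with a distinguished member and acyclic mixed pieces
    {α : Type} [Finite α] (W : α → B.Opens) (hW : ∀ a, IsAffineOpen (W a)) (hWcov : ⨆ a, W a = ⊤)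
    (a₀ : α)
    (hvan : ∀ b, b ≠ a₀ → ∀ {κ : Type} (G : κ → Z.Opens), ⨆ j, G j = σB ⁻¹ᵁ (W a₀ ⊓ W b) →
      cechZ1 (τ ≫ ξ) G ≤ cechB1 (τ ≫ ξ) G)
    -- the chart: a resolution `σ : σ_B⁻¹(W a₀) → Spec N` over `Spec T`
    {N : Type} [CommRing N] [IsDomain N] [Algebra T N]
    (σ : ((σB ⁻¹ᵁ W a₀ : Z.Opens) : Scheme.{0}) ⟶ Spec (.of N)) (hσ : IsResolution σ)
    (hσT : (σB ⁻¹ᵁ W a₀).ι ≫ (τ ≫ ξ) = σ ≫ Spec.map (CommRingCat.ofHom (algebraMap T N)))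
    -- the localisation `T'` of `N`
    (T' : Type) [CommRing T'] [IsDomain T'] [Algebra N T'] (M : Submonoid N) [IsLocalization M T'] :
    HasGeometricGenusLE T' g := by
  classical
  haveI : IsProper ξ := hξ.isProper
  haveI : IsNoetherianRing (CommRingCat.of T) := ‹IsNoetherianRing T›
  haveI : IsLocalRing (CommRingCat.of T) := ‹IsLocalRing T›
  haveI : IsProper (τ ≫ ξ) := inferInstance
  haveI : IsLocallyNoetherian Z := LocallyOfFiniteType.isLocallyNoetherian (τ ≫ ξ)
  haveI : CompactSpace Z := QuasiCompact.compactSpace_of_compactSpace (τ ≫ ξ)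
  haveI : IsNoetherian Z := {}
  -- fibres of `B → Spec T` have dimension `≤ 1`
  have hfib : ∀ y : Spec (.of T), topologicalKrullDim (gB.fiber y) ≤ 1 :=
    topologicalKrullDim_fiber_le_one_of_isBirational hdimT hgB
  -- a finite affine cover `𝒰` of `Z` refining `σ_B⁻¹𝒲`
  obtain ⟨ι, _, U, r, hUaff, hUr, hUcov⟩ := exists_finite_affine_refinement Z
    (fun a => σB ⁻¹ᵁ W a) (by rw [← Scheme.Hom.preimage_iSup, hWcov]; exact Opens.map_top _)
  -- GW-GLUE: `ℓ_T Ȟ¹((U_i ∩ V)_i) ≤ ℓ_T Ȟ¹(𝒰)`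
  have hglue : Module.length T (CechH1 (τ ≫ ξ) (fun i => U i ⊓ σB ⁻¹ᵁ W a₀)) ≤
      Module.length T (CechH1 (τ ≫ ξ) U) := by
    refine length_cechH1_preimage_piece_le_of_GW hGW gB hfib σB (τ ≫ ξ) hσB W hW hWcov U r hUr
      hUcov a₀ fun b hb => hvan b hb _ ?_
    calc ⨆ i, U i ⊓ σB ⁻¹ᵁ W a₀ ⊓ σB ⁻¹ᵁ W b
        = ⨆ i, U i ⊓ (σB ⁻¹ᵁ W a₀ ⊓ σB ⁻¹ᵁ W b) := by simp_rw [inf_assoc]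
      _ = (⨆ i, U i) ⊓ (σB ⁻¹ᵁ W a₀ ⊓ σB ⁻¹ᵁ W b) := (iSup_inf_eq _ _).symm
      _ = σB ⁻¹ᵁ (W a₀ ⊓ W b) := by rw [hUcov, top_inf_eq, Scheme.Hom.preimage_inf]
  -- domination
  have hdom : Module.length T (CechH1 (τ ≫ ξ) U) ≤ (g : ℕ∞) :=
    length_cechH1_le_of_dominates_of_bound hdimT h12 ξ hξ g hbound τ hτ hZreg U hUaff hUcov
  -- the chart
  obtain ⟨X', f', hf', hX'⟩ := exists_isResolution_length_cechH1_le_of_chart (τ ≫ ξ) U hUaff hUcov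
    (σB ⁻¹ᵁ W a₀) (fun O hO => SeparatedAffinePreimage.isAffineOpen_inf_preimage σB gB hO (hW a₀))
    σ hσ hσT T' M
  exact ⟨X', f', hf', fun ι' _ U' hU' hU'cov =>
    ((hX' ι' U' hU' hU'cov).trans hglue).trans hdom⟩


/-- **U2e core over a PROJECTIVE middle model — the chart lemma WITHOUT the `GortzWedhorn2023_24_44_H2` binder.**
The statement of `hasGeometricGenusLE_of_chart` verbatim with the named-fact binder `hGW` REMOVED and ONE hypothesis added:
`hproj : IsProjectiveOverRing (Over.mk g_B)` — the middle model `g_B : B → Spec T` is projective over `T` (at the consumer of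
record `g_B` is a blow-up `affineBlowup.π _`, projective by `Resolution.affineBlowup.isProjectiveOverRing`).  The gluing step
then runs through the fact-free projective (S)-step `Morphisms.length_cechH1_preimage_piece_le_of_isProjectiveOverRing`
(`CechH1PreimageGluingProjective`, over p613816 `GortzWedhorn2023_24_44_H2_of_projective`'s core) with the fibre bound at the
closed point (`topologicalKrullDim_fiber_le_one_of_isBirational`); everything else is the proof above, unchanged.  Still
conditional on `Lipman1969_1_2` (domination step).  «Leaf L3 chart lemma unconditional in GW; nothing else» (desk census
F53-CONSUMER-CENSUS-v0 L3; critic REFEREE R21 (2); res-inputs-p-6).  The original theorem above is untouched (append-only).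
[cite: GortzWedhorn2023, Cor. 24.44 (projective case)] [cite: Lipman1969, Proposition (1.2) (p. 199)]
[cite: EGAIII1, Prop. (1.4.15)] -/
theorem hasGeometricGenusLE_of_chart_of_isProjectiveOverRing
    {T : Type} [CommRing T] [IsDomain T] [IsNoetherianRing T] [IsLocalRing T]
    (hdimT : ringKrullDim T ≤ 2)
    (h12 : Lipman1969_1_2.{0})
    -- the given resolution with the genus bound
    {X : Scheme.{0}} (ξ : X ⟶ Spec (.of T)) (hξ : IsResolution ξ) (g : ℕ)
    (hbound : ∀ (ι : Type) [Finite ι] (U : ι → X.Opens), (∀ i, IsAffineOpen (U i)) →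
      ⨆ i, U i = ⊤ → Module.length T (CechH1 ξ U) ≤ (g : ℕ∞))
    -- a regular `Z` dominating `X`
    {Z : Scheme.{0}} (τ : Z ⟶ X) [IsProper τ] (hτ : IsBirational τ) (hZreg : Scheme.IsRegular Z)
    -- the middle model `B` and `σ_B : Z → B` over `Spec T`
    {B : Scheme.{0}} [IsIntegral B] (gB : B ⟶ Spec (.of T)) [IsProper gB] (hgB : IsBirational gB)
    (hproj : Literature.AlgebraicGeometry.Crystalline.IsProjectiveOverRing
      (CategoryTheory.Over.mk gB : Literature.AlgebraicGeometry.Motives.SchemeOver T))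
    (σB : Z ⟶ B) (hσB : σB ≫ gB = τ ≫ ξ)
    -- a finite affine cover of `B` with a distinguished member and acyclic mixed pieces
    {α : Type} [Finite α] (W : α → B.Opens) (hW : ∀ a, IsAffineOpen (W a)) (hWcov : ⨆ a, W a = ⊤)
    (a₀ : α)
    (hvan : ∀ b, b ≠ a₀ → ∀ {κ : Type} (G : κ → Z.Opens), ⨆ j, G j = σB ⁻¹ᵁ (W a₀ ⊓ W b) →
      cechZ1 (τ ≫ ξ) G ≤ cechB1 (τ ≫ ξ) G)
    -- the chart: a resolution `σ : σ_B⁻¹(W a₀) → Spec N` over `Spec T`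
    {N : Type} [CommRing N] [IsDomain N] [Algebra T N]
    (σ : ((σB ⁻¹ᵁ W a₀ : Z.Opens) : Scheme.{0}) ⟶ Spec (.of N)) (hσ : IsResolution σ)
    (hσT : (σB ⁻¹ᵁ W a₀).ι ≫ (τ ≫ ξ) = σ ≫ Spec.map (CommRingCat.ofHom (algebraMap T N)))
    -- the localisation `T'` of `N`
    (T' : Type) [CommRing T'] [IsDomain T'] [Algebra N T'] (M : Submonoid N) [IsLocalization M T'] :
    HasGeometricGenusLE T' g := by
  classical
  haveI : IsProper ξ := hξ.isProper
  haveI : IsNoetherianRing (CommRingCat.of T) := ‹IsNoetherianRing T›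
  haveI : IsLocalRing (CommRingCat.of T) := ‹IsLocalRing T›
  haveI : IsProper (τ ≫ ξ) := inferInstance
  haveI : IsLocallyNoetherian Z := LocallyOfFiniteType.isLocallyNoetherian (τ ≫ ξ)
  haveI : CompactSpace Z := QuasiCompact.compactSpace_of_compactSpace (τ ≫ ξ)
  haveI : IsNoetherian Z := {}
  -- fibres of `B → Spec T` have dimension `≤ 1`
  have hfib : ∀ y : Spec (.of T), topologicalKrullDim (gB.fiber y) ≤ 1 :=
    topologicalKrullDim_fiber_le_one_of_isBirational hdimT hgB
  -- a finite affine cover `𝒰` of `Z` refining `σ_B⁻¹𝒲`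
  obtain ⟨ι, _, U, r, hUaff, hUr, hUcov⟩ := exists_finite_affine_refinement Z
    (fun a => σB ⁻¹ᵁ W a) (by rw [← Scheme.Hom.preimage_iSup, hWcov]; exact Opens.map_top _)
  -- GLUE over the PROJECTIVE middle model (p613816 twin; no named fact): `ℓ_T Ȟ¹((U_i ∩ V)_i) ≤ ℓ_T Ȟ¹(𝒰)`
  have hglue : Module.length T (CechH1 (τ ≫ ξ) (fun i => U i ⊓ σB ⁻¹ᵁ W a₀)) ≤
      Module.length T (CechH1 (τ ≫ ξ) U) := by
    refine length_cechH1_preimage_piece_le_of_isProjectiveOverRing gB hproj (hfib (closedPoint T)) σB (τ ≫ ξ)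
      hσB W hW hWcov U r hUr hUcov a₀ fun b hb => hvan b hb _ ?_
    calc ⨆ i, U i ⊓ σB ⁻¹ᵁ W a₀ ⊓ σB ⁻¹ᵁ W b
        = ⨆ i, U i ⊓ (σB ⁻¹ᵁ W a₀ ⊓ σB ⁻¹ᵁ W b) := by simp_rw [inf_assoc]
      _ = (⨆ i, U i) ⊓ (σB ⁻¹ᵁ W a₀ ⊓ σB ⁻¹ᵁ W b) := (iSup_inf_eq _ _).symm
      _ = σB ⁻¹ᵁ (W a₀ ⊓ W b) := by rw [hUcov, top_inf_eq, Scheme.Hom.preimage_inf]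
  -- domination
  have hdom : Module.length T (CechH1 (τ ≫ ξ) U) ≤ (g : ℕ∞) :=
    length_cechH1_le_of_dominates_of_bound hdimT h12 ξ hξ g hbound τ hτ hZreg U hUaff hUcov
  -- the chart
  obtain ⟨X', f', hf', hX'⟩ := exists_isResolution_length_cechH1_le_of_chart (τ ≫ ξ) U hUaff hUcov
    (σB ⁻¹ᵁ W a₀) (fun O hO => SeparatedAffinePreimage.isAffineOpen_inf_preimage σB gB hO (hW a₀))
    σ hσ hσT T' M
  exact ⟨X', f', hf', fun ι' _ U' hU' hU'cov =>
    ((hX' ι' U' hU' hU'cov).trans hglue).trans hdom⟩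

end Summit.ResolutionOfSingularities.ResolutionOfSingularities.Theorems.SurfaceTermination.GenusDescent

end
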